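import Literature.AlgebraicGeometry.Resolution.LipmanProcedure
import Literature.AlgebraicGeometry.Resolution.AffineBlowupUniversal
import Literature.AlgebraicGeometry.Resolution.ArithmeticalThreefoldsBlowupFormProofs
import Literature.AlgebraicGeometry.Resolution.IdealSheafLemmas
import HarnessLib

/-!
# Crux `FrobeniusLadder.FRationalResolution` (stmt-ResolutionOfSingularities-15317), line `redirect`,
# stub `stub_diagonalizableQuotientResolution` — **on an affine chart the intrinsic centre `𝓘_{Sing}` IS the ideal sheaf
# of any radical ideal cutting out the singular locus, and the affine blow-up of that ideal IS the blow-up along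
# `𝓘_{Sing}`** (design C3 = the rank-2 stratum layer of the non-isolated case, memo MEMO-15317-leafhand2-g10 §2 (L3-a):
# the scheme-side dictionary that turns the ring-level description of the singular locus of a cone chart algebra
# (`…FixedStratumBlowupPoints`, `…FixedStratumBaseSingular`) and the radicality of the chain ideal
# (`…FixedStratumCentre`, `…FixedStratumRadicalNearby`) into the statement «`Bl_{𝓘_{Sing}}` of the chart is
# `affineBlowup (χ(s))`», to be combined with `BlowupExit.isBlowup_pullback_snd_singularLocusIdeal_of_etale`)

* `vanishingIdeal_zeroLocus_eq_idealSheaf_of_isRadical` — on `Spec R`, for a RADICAL ideal `I`, the vanishing ideal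
  sheaf of `V(I)` is the ideal sheaf of `I` (`affineBlowup.idealSheaf I`);
* **`singularLocusIdeal_Spec_eq_idealSheaf`** — if moreover `V(I) = Sing(Spec R)` pointwise
  (`¬ IsRegularLocalRing R_𝔔 ↔ I ⊆ 𝔔`), then `singularLocusIdeal (Spec R) f = affineBlowup.idealSheaf I`;
* **`isBlowup_affineBlowup_singularLocusIdeal`** — hence `affineBlowup.π I` is a blowing up of `Spec R` along its
  reduced singular locus.

Honest label: scheme-side dictionary toward ONE leaf stub (no stub, crux or summit closed). No definitions, no named
facts, no sorry. [cite: Liu2002, §8.3.4, (3.11)] [cite: GortzWedhorn2020, Prop. 13.92] [folklore]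
-/

noncomputable section

-- single-problem summit: the doubled namespace component is forced
set_option linter.dupNamespace false

open CategoryTheory AlgebraicGeometry TopologicalSpace Opposite
open AlgebraicGeometry.Scheme.IdealSheafData
open Literature.AlgebraicGeometry.Resolution

namespace Summit.ResolutionOfSingularities.ResolutionOfSingularities.Theorems.FRationalResolution.FixedStratumAffineCentre

universe u

-- adapted from `…EquisingularLiftEquisingularLiftNatNDTransportInit.vanishingIdeal_zeroLocus_eq_ofIdealTop`
/-- **On `Spec R`, the vanishing ideal sheaf of `V(I)` is the ideal sheaf of the radical ideal `I`.** [folklore] -/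
theorem vanishingIdeal_zeroLocus_eq_idealSheaf_of_isRadical {R : Type u} [CommRing R] (I : Ideal R)
    (hI : I.IsRadical) :
    vanishingIdeal (⟨PrimeSpectrum.zeroLocus (I : Set R), PrimeSpectrum.isClosed_zeroLocus _⟩ :
        Closeds (Spec (.of R))) = affineBlowup.idealSheaf I := by
  refine Scheme.IdealSheafData.ext_of_isAffine ?_
  have hsurj : Function.Surjective (Scheme.ΓSpecIso (.of R)).inv.hom :=
    (ConcreteCategory.bijective_of_isIso (C := CommRingCat) (Scheme.ΓSpecIso (.of R)).inv).2
  have hinj : Function.Injective (Scheme.ΓSpecIso (.of R)).inv.hom :=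
    (ConcreteCategory.bijective_of_isIso (C := CommRingCat) (Scheme.ΓSpecIso (.of R)).inv).1
  have hpre : ((isAffineOpen_top (Spec (CommRingCat.of R))).fromSpec : _ → Spec (CommRingCat.of R)) ⁻¹'
      PrimeSpectrum.zeroLocus (I : Set R) =
      PrimeSpectrum.zeroLocus ((Scheme.ΓSpecIso (.of R)).inv.hom '' (I : Set R)) := by
    rw [IsAffineOpen.fromSpec_top, Scheme.isoSpec_Spec_inv]
    ext q
    rw [Set.mem_preimage, Spec.map_apply]
    exact Set.ext_iff.mp (PrimeSpectrum.preimage_comap_zeroLocus (Scheme.ΓSpecIso (.of R)).inv.hom (I : Set R)) q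
  rw [affineBlowup.idealSheaf, ideal_ofIdealTop_top, Scheme.IdealSheafData.vanishingIdeal_ideal, Closeds.coe_mk]
  have hgoal : PrimeSpectrum.vanishingIdeal
      (PrimeSpectrum.zeroLocus ((Scheme.ΓSpecIso (.of R)).inv.hom '' (I : Set R))) =
      I.map (Scheme.ΓSpecIso (.of R)).inv.hom := by
    rw [← PrimeSpectrum.zeroLocus_span, PrimeSpectrum.vanishingIdeal_zeroLocus_eq_radical, ← Ideal.map_span,
      Ideal.span_eq, ← Ideal.map_radical_of_surjective hsurj ((RingHom.injective_iff_ker_eq_bot _).mp hinj ▸ bot_le),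
      hI.radical]
  exact (congrArg PrimeSpectrum.vanishingIdeal hpre).trans hgoal

/-- **`𝓘_{Sing(Spec R)}` is the ideal sheaf of any radical ideal cutting out the singular locus.** [cite: Liu2002, §8.3.4, (3.11)] -/
theorem singularLocusIdeal_Spec_eq_idealSheaf {k : Type u} [Field k] {R : Type u} [CommRing R]
    (f : Spec (.of R) ⟶ Spec (.of k)) [LocallyOfFiniteType f] (I : Ideal R) (hI : I.IsRadical)
    (hZ : ∀ 𝔔 : PrimeSpectrum R, ¬ IsRegularLocalRing (Localization.AtPrime 𝔔.asIdeal) ↔ I ≤ 𝔔.asIdeal) :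
    singularLocusIdeal (Spec (.of R)) f = affineBlowup.idealSheaf I := by
  have hset : singularLocusClosed (Spec (.of R)) f =
      (⟨PrimeSpectrum.zeroLocus (I : Set R), PrimeSpectrum.isClosed_zeroLocus _⟩ : Closeds (Spec (.of R))) := by
    apply Closeds.ext
    rw [coe_singularLocusClosed, Closeds.coe_mk, regularLocus_Spec_eq]
    ext x
    simp only [Set.mem_compl_iff, Set.mem_setOf_eq]
    exact (hZ x).trans SetLike.coe_subset_coe.symm
  rw [singularLocusIdeal, hset]
  exact vanishingIdeal_zeroLocus_eq_idealSheaf_of_isRadical I hI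

/-- **The affine blow-up of such an ideal is the blow-up along the reduced singular locus.**
[cite: GortzWedhorn2020, Prop. 13.92] [cite: Liu2002, §8.3.4] -/
theorem isBlowup_affineBlowup_singularLocusIdeal {k : Type u} [Field k] {R : Type u} [CommRing R]
    (f : Spec (.of R) ⟶ Spec (.of k)) [LocallyOfFiniteType f] (I : Ideal R) (hI : I.IsRadical)
    (hZ : ∀ 𝔔 : PrimeSpectrum R, ¬ IsRegularLocalRing (Localization.AtPrime 𝔔.asIdeal) ↔ I ≤ 𝔔.asIdeal) :
    IsBlowup (affineBlowup.π I) (singularLocusIdeal (Spec (.of R)) f) := by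
  rw [singularLocusIdeal_Spec_eq_idealSheaf f I hI hZ]
  exact affineBlowup.isBlowup I

end Summit.ResolutionOfSingularities.ResolutionOfSingularities.Theorems.FRationalResolution.FixedStratumAffineCentre

end
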